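import Mathlib
import HarnessLib
import Summits.RiemannHypothesis.RiemannHypothesis.Theses.WeilParity
import Summits.RiemannHypothesis.RiemannHypothesis.Theses.GroundBarta
import Summits.RiemannHypothesis.RiemannHypothesis.Theorems.WeilParityEvenWinsBeyondArchTwoThreeWindow
import Summits.RiemannHypothesis.RiemannHypothesis.Theorems.GroundBartaEvenWinsBeyondArchCellsUpTo80

/-!
# The three-prime window up to `4023/5000 = 0.8046`: the RH-free parity frontier and the residues of the cruxes
# `NoParityCrossing` (stmt-RiemannHypothesis-18085), `GroundStateSimpleEven` (stmt-RiemannHypothesis-1526) and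
# `EvenWinsBeyondArch` (stmt-RiemannHypothesis-15432; GroundBarta rung 4 = stmt-RiemannHypothesis-18807)

Support file (`--supports stmt-RiemannHypothesis-18085`), RH-free, Mathlib + landed tree files only; no definitions, no named
facts, no `sorry`.  Prover A (speedrun unit `sr-gb-rung-a`, gen 7).

`weilWindowSimpleEven_upTo_M80` (…CellsUpTo80: five deflated-Temple cells `[2/3, 18/25]`, `[18/25, 3/4]`, `[3/4, 77/100]`,
`[77/100, 39/50]`, `[39/50, 4023/5000]` beyond the `{2,3}`-window, the last one on the `N = 271` certificate format) gives the
Connes–van Suijlekom clause on EVERY window `0 < a ≤ 4023/5000` — the whole range where at most the prime powers `2, 3, 4` are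
visible except the sliver `(0.8046, (log 5)/2]` of length `1.2·10⁻⁴` (`(log 5)/2 = 0.80471…`).  Consequences recorded here:

1. the strict parity order `ε_ev(a) < ε_od(a)` and "every ground state is a.e. even" on every window `0 < a ≤ 4023/5000`;
2. item 18085 ↔ "no parity tie beyond `4023/5000`" ↔ `GroundStateSimpleEven`; the ladder composition with only the RH-strength
   tail left: `(∀ a > 4023/5000, WeilWindowSimpleEven a) → NoParityCrossing`;
3. `EvenWinsBeyondArch` (WeilParity) and GroundBarta's rung 4 from the tail beyond `4023/5000` alone, and what they still assert;
4. the even sector wins on every window `0 < a ≤ 4023/5000`.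
-/

noncomputable section

open Set MeasureTheory

-- D-0017: single-problem summit ⇒ namespace `Summit.RiemannHypothesis.RiemannHypothesis.…` by design.
set_option linter.dupNamespace false

namespace Summit.RiemannHypothesis.RiemannHypothesis.Theorems.EvenWinsBeyondArch

open Literature.NumberTheory.LFunctions
open Summit.RiemannHypothesis.RiemannHypothesis.Theses.WeilParity
open Summit.RiemannHypothesis.RiemannHypothesis.Theses.WeilGroundState

/-! ## The clause, the strict parity order and even ground states up to `4023/5000` -/

/-- **Strict parity order up to `4023/5000`**: `ε_ev(a) < ε_od(a)` for `0 < a ≤ 4023/5000`. RH-free. [folklore] -/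
theorem weilEvenGroundEnergy_lt_weilOddGroundEnergy_of_le_8046 {a : ℝ} (ha : 0 < a) (hhi : a ≤ 4023 / 5000) :
    weilEvenGroundEnergy a < weilOddGroundEnergy a :=
  (weilWindowSimpleEven_iff_weilEvenGroundEnergy_lt ha).1 (weilWindowSimpleEven_upTo_M80 a ha hhi)

/-- **No parity tie on `(0, 4023/5000]`**: the conclusion of item 18085 (`ε_ev(a) ≠ ε_od(a)`) on every window up to `4023/5000`,
RH-free. [folklore] -/
theorem weilEvenGroundEnergy_ne_weilOddGroundEnergy_of_le_8046 {a : ℝ} (ha : 0 < a) (hhi : a ≤ 4023 / 5000) :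
    weilEvenGroundEnergy a ≠ weilOddGroundEnergy a :=
  (weilEvenGroundEnergy_lt_weilOddGroundEnergy_of_le_8046 ha hhi).ne

/-- **Every ground state at every window `0 < a ≤ 4023/5000` is a.e. even.** [folklore] -/
theorem groundStates_ae_even_of_le_8046 :
    ∀ a : ℝ, 0 < a → a ≤ 4023 / 5000 → ∀ u : ℝ → ℂ, IsWeilGroundState a u → u =ᵐ[volume] fun t ↦ u (-t) :=
  fun a ha hhi ↦ (GroundStateSimpleEven.weilWindowSimpleEven_iff_groundStates_ae_even ha).1
    (weilWindowSimpleEven_upTo_M80 a ha hhi)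

/-! ## The residue: the tail beyond `4023/5000` (RH-strength) -/

/-- **No tie beyond `4023/5000` ⟹ `NoParityCrossing`** (item stmt-RiemannHypothesis-18085). [folklore] -/
theorem noParityCrossing_of_beyond_8046
    (h : ∀ a : ℝ, 4023 / 5000 < a → weilEvenGroundEnergy a ≠ weilOddGroundEnergy a) : NoParityCrossing := by
  intro a ha
  rcases le_or_gt a (4023 / 5000) with hle | hlt
  · have ha0 : 0 < a := lt_trans (div_pos (Real.log_pos (by norm_num)) two_pos) ha
    exact ne_of_lt (weilEvenGroundEnergy_lt_weilOddGroundEnergy_of_le_8046 ha0 hle)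
  · exact h a hlt

/-- **`NoParityCrossing` ⟹ no tie beyond `4023/5000`** (trivial restriction; `(log 3)/2 < 0.55 < 4023/5000`). [folklore] -/
theorem beyond_8046_of_noParityCrossing (h : NoParityCrossing) :
    ∀ a : ℝ, 4023 / 5000 < a → weilEvenGroundEnergy a ≠ weilOddGroundEnergy a := by
  intro a ha
  have hl3 := Real.log_three_lt_d9
  exact h a (by linarith)

/-- **Item 18085 after the three-prime cells: `NoParityCrossing` ↔ no parity tie beyond `4023/5000`.** [folklore] -/
theorem noParityCrossing_iff_beyond_8046 :
    NoParityCrossing ↔ ∀ a : ℝ, 4023 / 5000 < a → weilEvenGroundEnergy a ≠ weilOddGroundEnergy a :=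
  ⟨beyond_8046_of_noParityCrossing, noParityCrossing_of_beyond_8046⟩

/-- **The ladder with everything below `4023/5000` discharged**: Connes' clause on the tail `a > 4023/5000` alone proves
item 18085. [folklore] -/
theorem noParityCrossing_of_tailSimpleEven_8046
    (h₂ : ∀ a : ℝ, 4023 / 5000 < a → Literature.NumberTheory.LFunctions.WeilWindowSimpleEven a) : NoParityCrossing :=
  noParityCrossing_of_beyond_8046 fun a ha ↦
    ((weilWindowSimpleEven_iff_weilEvenGroundEnergy_lt (lt_trans (by norm_num) ha)).1 (h₂ a ha)).ne

/-- **`GroundStateSimpleEven` (stmt-RiemannHypothesis-1526) ↔ no parity tie beyond `4023/5000`.** [folklore] -/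
theorem groundStateSimpleEven_iff_noParityCrossingBeyond_8046 :
    GroundStateSimpleEven ↔ ∀ a : ℝ, 4023 / 5000 < a → weilEvenGroundEnergy a ≠ weilOddGroundEnergy a :=
  GroundStateSimpleEven.groundStateSimpleEven_iff_noParityCrossing.trans noParityCrossing_iff_beyond_8046

/-- **`GroundStateSimpleEven` ↔ Connes' clause on the tail `a > 4023/5000`** (on `(0, 4023/5000]` the clause is a theorem). [folklore] -/
theorem groundStateSimpleEven_iff_tailSimpleEven_8046 :
    GroundStateSimpleEven ↔ ∀ a : ℝ, 4023 / 5000 < a → WeilWindowSimpleEven a := by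
  refine ⟨fun h a ha ↦ h a (lt_trans (by norm_num) ha), fun h a ha ↦ ?_⟩
  rcases le_or_gt a (4023 / 5000) with hle | hlt
  · exact weilWindowSimpleEven_upTo_M80 a ha hle
  · exact h a hlt

/-- **The crux `EvenWinsBeyondArch` from "no tie beyond `4023/5000`"** (landed split glue). [folklore] -/
theorem evenWinsBeyondArch_of_noTie_beyond_8046
    (hne : ∀ a : ℝ, 4023 / 5000 < a → weilEvenGroundEnergy a ≠ weilOddGroundEnergy a) : EvenWinsBeyondArch :=
  evenWinsBeyondArch_of_subs WeilParity.onePrimeWindowSimpleEven_proof (noParityCrossing_of_beyond_8046 hne)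

/-- **The crux `EvenWinsBeyondArch` from Connes' clause on the tail `a > 4023/5000`.** [folklore] -/
theorem evenWinsBeyondArch_of_tailSimpleEven_8046
    (h₂ : ∀ a : ℝ, 4023 / 5000 < a → WeilWindowSimpleEven a) : EvenWinsBeyondArch :=
  evenWinsBeyondArch_of_subs WeilParity.onePrimeWindowSimpleEven_proof (noParityCrossing_of_tailSimpleEven_8046 h₂)

/-- **What the crux still asserts**: `EvenWinsBeyondArch ↔ ∀ a > 4023/5000, ε_ev(a) ≤ ε_od(a)`. [folklore] -/
theorem evenWinsBeyondArch_iff_forall_le_beyond_8046 :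
    EvenWinsBeyondArch ↔ ∀ a : ℝ, 4023 / 5000 < a → weilEvenGroundEnergy a ≤ weilOddGroundEnergy a := by
  rw [evenWinsBeyondArch_iff_forall_le]
  refine ⟨fun h a ha ↦ h a (lt_trans (by have := Real.log_two_lt_d9; linarith) ha), fun h a ha ↦ ?_⟩
  rcases le_or_gt a (4023 / 5000) with hle | hlt
  · exact (weilEvenGroundEnergy_lt_weilOddGroundEnergy_of_le_8046 (log_two_half_pos.trans ha) hle).le
  · exact h a hlt

/-- **A failure of the crux forces an exact parity tie at some window `a > 4023/5000`.** [folklore] -/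
theorem exists_tie_beyond_8046_of_not_evenWinsBeyondArch (h : ¬ EvenWinsBeyondArch) :
    ∃ a : ℝ, 4023 / 5000 < a ∧ weilEvenGroundEnergy a = weilOddGroundEnergy a := by
  by_contra hne
  push Not at hne
  exact h (evenWinsBeyondArch_of_noTie_beyond_8046 hne)

end Summit.RiemannHypothesis.RiemannHypothesis.Theorems.EvenWinsBeyondArch

/-! ## The route thesis on every window up to `4023/5000`, and the GroundBarta transport -/

namespace Summit.RiemannHypothesis.RiemannHypothesis.Theorems.WeilParity

open Literature.NumberTheory.LFunctions

/-- **The even sector wins on every window `0 < a ≤ 4023/5000`** (RH-free): every odd `L²`-normalised Weil test on `[-a, a]`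
is matched up to any `δ > 0` by an even one. [folklore] -/
theorem evenSectorWins_upTo_8046 :
    ∀ a : ℝ, 0 < a → a ≤ 4023 / 5000 → ∀ o : ℝ → ℂ,
      Literature.NumberTheory.LFunctions.IsWeilTest o → tsupport o ⊆ Set.Icc (-a) a →
      (∀ t, o (-t) = -o t) → ∫ t, ‖o t‖ ^ 2 = (1 : ℝ) → ∀ δ : ℝ, 0 < δ →
        ∃ e : ℝ → ℂ, Literature.NumberTheory.LFunctions.IsWeilTest e ∧ tsupport e ⊆ Set.Icc (-a) a ∧
          (∀ t, e (-t) = e t) ∧ ∫ t, ‖e t‖ ^ 2 = (1 : ℝ) ∧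
          (Literature.NumberTheory.LFunctions.weilQuadratic e).re ≤
            (Literature.NumberTheory.LFunctions.weilQuadratic o).re + δ :=
  fun _ ha hle ↦ evenWinsAt_of_le ha
    (EvenWinsBeyondArch.weilEvenGroundEnergy_lt_weilOddGroundEnergy_of_le_8046 ha hle).le

end Summit.RiemannHypothesis.RiemannHypothesis.Theorems.WeilParity

namespace Summit.RiemannHypothesis.RiemannHypothesis.Theorems.GroundBarta

open Literature.NumberTheory.LFunctions

/-- **GroundBarta's rung 4 from "no tie beyond `4023/5000`"** (transport along the `Iff.rfl` copy
`GroundBarta.evenWinsBeyondArch_iff_weilParity`). [folklore] -/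
theorem evenWinsBeyondArch_of_noTie_beyond_8046
    (hne : ∀ a : ℝ, 4023 / 5000 < a → weilEvenGroundEnergy a ≠ weilOddGroundEnergy a) :
    Summit.RiemannHypothesis.RiemannHypothesis.Theses.GroundBarta.EvenWinsBeyondArch :=
  evenWinsBeyondArch_iff_weilParity.2 (EvenWinsBeyondArch.evenWinsBeyondArch_of_noTie_beyond_8046 hne)

/-- **GroundBarta's rung 4 from Connes' clause on the tail `a > 4023/5000`.** [folklore] -/
theorem evenWinsBeyondArch_of_tailSimpleEven_8046
    (h₂ : ∀ a : ℝ, 4023 / 5000 < a → WeilWindowSimpleEven a) :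
    Summit.RiemannHypothesis.RiemannHypothesis.Theses.GroundBarta.EvenWinsBeyondArch :=
  evenWinsBeyondArch_iff_weilParity.2 (EvenWinsBeyondArch.evenWinsBeyondArch_of_tailSimpleEven_8046 h₂)

/-- **What GroundBarta's rung 4 still asserts**: `↔ ∀ a > 4023/5000, ε_ev(a) ≤ ε_od(a)`. [folklore] -/
theorem evenWinsBeyondArch_iff_forall_le_beyond_8046 :
    Summit.RiemannHypothesis.RiemannHypothesis.Theses.GroundBarta.EvenWinsBeyondArch ↔
      ∀ a : ℝ, 4023 / 5000 < a → weilEvenGroundEnergy a ≤ weilOddGroundEnergy a :=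
  evenWinsBeyondArch_iff_weilParity.trans EvenWinsBeyondArch.evenWinsBeyondArch_iff_forall_le_beyond_8046

end Summit.RiemannHypothesis.RiemannHypothesis.Theorems.GroundBarta

end
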